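import Summits.QuantumFields.BalabanUV.Beta.GAN24.KFibLegSource

/-!
# `BalabanUV.Beta.GAN24.KFibClosedForm` — binder row G-an2-4 / (CONV-C), road P1-fibre, leaf **P1-L05b** (part 3/3): the fibre function
# `CombesThomasFibreStep.kFib` of the unit-normalised step resolvent IS, at real quasi-momentum, a SINGLE ALIAS SUM of leaf-15's per-alias formula
# against the M-level READING WEIGHT, with ONE Bloch-aggregated SOURCE per leg (S1b′/S1c of `SKELETON-P1.md`; `diag/kkt_fourier.py: kmat_closed`)

NOT IN PRINT; OUR PROOF ATTEMPT.  HONEST FRAMING (cell contract, verbatim): «discharging `BetaPertH` makes Bałaban's UV stability UNCONDITIONAL — a real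
constructive-QFT result; it is NOT the continuum limit and NOT the Clay problem.»  HONEST DEPENDENCY (verbatim): «continuum YM on T⁴ ⇐ BetaPertH ∧ nine spine
estimates (0/9 proved); BetaPertH ⇐ (D1) ∧ (D4) ∧ CAP+tail; G-an2-4 gates asym, D1 and NE2/3/4.»  [folklore] finite sums / finite-dimensional linear algebra over `ℂ`:
an IDENTIFICATION (no estimate, no cited fact, no wall binder, no `def … : Prop` fact).  NOT summit progress; nothing of (CONV-C)'s K-slot is discharged here.

## What is proved (generic `d`; blocking `N ≥ 1`, decimation `M`, units `s_f, s_m`; REAL quasi-momentum `p = ofRealVec q` with `hL : ∀ m, L_m ≠ 0`;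
## `F = FibreArrow.aliasFibre p hL`; `C_f = legCoef … (inl ·) = s_f·M^{−(d+2)}`, `C_m = legCoef … (inr ·) = s_m`; inputs §1–§2 = `GAN24/KFibLegSource`)
§3 BOOKKEEPING: `kFibW_eq_readout` — `kFibW … a x′ b y′ p = Σ_{i ∈ legSet a} C_a · cphase(quo N P_i) p · ((fibreMatrix (blochChar p))⁻¹ *ᵥ legSrcVec … C_b b y′)(legIdx a P_i)`
   (every complex `p`); `readout_inl` — on a field leg the synthesis `Σ_m A m κ · pw k_m (repZ z)` reads out as `Σ_m C · readW N M p κ x′ m · A m κ` with the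
   M-level READING WEIGHT `readW N M p κ x′ m = Σ_{i ∈ LegIdx d M} pw k_m (legPt M (inl κ) x′ i)` (= `e^{ik_m·Mx′} S_M(m) s_{M,κ}(m)` of S1c).
§4 **THE CLOSED FORM** (four leg types): `kFibW … (inl κ) x′ (inl l) y′ p = Σ_m C_f·readW(κ,x′,m) · Ablk F (fieldLegSrc … C_f l y′) 0 φ c m κ` for any `(φ,c)` solving
   the capacitance system with sources `(fieldLegSrc, 0, 0, 0)`; `… (inr κ) x′ (inl l) y′ p = C_m·cphase(quo N (M•x′)) p · φ κ`; `… (inl κ) x′ (inr l) y′ p =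
   Σ_m C_f·readW · Ablk F 0 0 φ′ c′ m κ` and `… (inr κ) x′ (inr l) y′ p = C_m·cphase(quo N (M•x′)) p · φ′ κ` for `(φ′,c′)` solving the system with the sources
   `(0, 0, 0, C_m·cphase(−quo N (M•y′)) p • e_l)`; and the same four for `kFib Lc s_f s_m j` (`N = Lc^(j+1)`, `M = Lc^j`).  The solutions exist and are unique
   (`FibInvClosedForm.capSolves_inv`, `Capacitance.isUnit_capMat`/`cap_unique`), so every right-hand side is `Cap⁻¹` applied to ONE aggregated source:
   `kmat_closed`'s `kk` loop (reading weight `Wread`, source `conj(Wread)/N^D`, per-source capacitance solve, `Σ_m Wread·Ahat`) as a kernel identity — row P1-L05b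
   «`kFib = closed form` on the regular real zone».  The bridge to T00's `AliasObjects.kFibClosed` is a renaming once that file lands.
Unit `b2b-balaban-gan24-formalise-leaf-05` (G-an2-4 formalisation swarm), 2026-08-20.
-/

noncomputable section

open Complex Finset
open scoped BigOperators Matrix
open Literature.MathematicalPhysics.QuantumFieldTheory
open Literature.MathematicalPhysics.QuantumFieldTheory.Balaban1983to89
open Literature.MathematicalPhysics.QuantumFieldTheory.Balaban1983to89.Beta
open Literature.MathematicalPhysics.QuantumFieldTheory.LatticeForm (repZ quo)
open Literature.Probability.LatticeModels (TorusSite Torus.proj)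
open B4Strip (ofRealVec)
open AffineAveraging (Site)
open BlochFibreMatrix (Idx blochChar blochChar_apply fibreFun fibreMatrix fibreMatrix_mulVec)
open FibreInverseDecay (cphase)
open OneStepResolventKernel (Fib)
open OneStepKernelFamily (LegIdx legSet legPt legW)
open Summit.QuantumFields.BalabanUV.Beta.HessKerDressedUnits (legScale)
open Summit.QuantumFields.BalabanUV.Beta.GAN24.FibreSymbols (pw lapSym)
open Summit.QuantumFields.BalabanUV.Beta.GAN24.FibreDFT (kFine amp pw_neg pw_kFine_site)
open Summit.QuantumFields.BalabanUV.Beta.GAN24.CapacitanceSolve (Fibre CapSolves Ablk)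
open Summit.QuantumFields.BalabanUV.Beta.GAN24.FibreArrow (srcEL rG srcG aliasFibre)
open Summit.QuantumFields.BalabanUV.Beta.GAN24.Capacitance (bordered_inverse amp_zero')
open Summit.QuantumFields.BalabanUV.Beta.GAN24.CombesThomasFibre (fibInv legIdx)
open Summit.QuantumFields.BalabanUV.Beta.GAN24.CombesThomasFibreStep (legOff kFibW kFib cphase_add_eq_mul)
open Summit.QuantumFields.BalabanUV.Beta.GAN24.FibInvClosedForm (fibInv_eq_inv_apply isUnit_det_fibreMatrix norm_blochChar_ofRealVec)
open Summit.QuantumFields.BalabanUV.Beta.GAN24.KFibLegSource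

namespace Summit.QuantumFields.BalabanUV.Beta.GAN24.KFibClosedForm

variable {d N : ℕ} [NeZero N]

/-! ## §3 The readout: the `a`-leg sum of the synthesis is the M-level reading weight -/

/-- [folklore] THE LEG COEFFICIENT `C_a = D_a · w_a` (`s_f·M^{−(d+2)}` on a field leg, `s_m` on a multiplier leg), as a complex number. -/
def legCoef (M : ℕ) (sf sm : ℝ) (a : Fib d) : ℂ := ((legScale (d := d) sf sm a * legW d M a : ℝ) : ℂ)

/-- [folklore] The weight of `kFibW` splits into the two leg coefficients. -/
theorem kFibW_weight_eq (M : ℕ) (sf sm : ℝ) (a b : Fib d) :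
    (((legScale (d := d) sf sm a * legScale (d := d) sf sm b * (legW d M a * legW d M b) : ℝ)) : ℂ) = legCoef M sf sm a * legCoef M sf sm b := by
  unfold legCoef; push_cast; ring

omit [NeZero N] in
/-- [folklore] The phase of `kFibW` splits into the reading phase and the reflected source phase. -/
theorem cphase_legOff (M : ℕ) (a : Fib d) (x' : Site (d + 1)) (i : (Fin (d + 1) → ℕ) × ℕ) (b : Fib d) (y' : Site (d + 1))
    (i' : (Fin (d + 1) → ℕ) × ℕ) (p : Fin (d + 1) → ℂ) :
    cphase (legOff N M a x' i b y' i') p = cphase (quo N (legPt M a x' i)) p * cphase (-quo N (legPt M b y' i')) p := by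
  unfold legOff
  rw [sub_eq_add_neg, cphase_add_eq_mul]

/-- [folklore] **`kFibW` AS A READOUT OF `(fibreMatrix)⁻¹ *ᵥ legSrcVec`** (every complex `p`; pure bookkeeping: product sum ↦ iterated sum, the `b`-leg sum pushed
onto the right-hand side by §1). -/
theorem kFibW_eq_readout (M : ℕ) (sf sm : ℝ) (a : Fib d) (x' : Site (d + 1)) (b : Fib d) (y' : Site (d + 1)) (p : Fin (d + 1) → ℂ) :
    kFibW N M sf sm a x' b y' p
      = ∑ i ∈ legSet d M a, legCoef M sf sm a * cphase (quo N (legPt M a x' i)) p *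
          ((fibreMatrix (N := N) (⇑(blochChar p)))⁻¹ *ᵥ legSrcVec N M p (legCoef M sf sm b) b y') (legIdx N a (legPt M a x' i)) := by
  unfold kFibW
  rw [Finset.sum_product]
  refine Finset.sum_congr rfl fun i _ => ?_
  rw [← sum_leg_fibInv_eq_invMulVec, Finset.mul_sum]
  refine Finset.sum_congr rfl fun i' _ => ?_
  rw [kFibW_weight_eq, cphase_legOff]
  ring

/-- [folklore] **THE FIELD-LEG READOUT COLLAPSES TO THE READING WEIGHT**: if the field entries of a vector `v` are the synthesis `Σ_m A m κ · pw k_m (repZ z)`, then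
`Σ_{i ∈ LegIdx} C · cphase(quo N P_i) p · v (inl (κ, proj N P_i)) = Σ_m C · readW N M p κ x′ m · A m κ` (`FibreDFT.pw_kFine_site`). -/
theorem readout_inl (M : ℕ) (p : Fin (d + 1) → ℂ) (C : ℂ) (κ : Fin (d + 1)) (x' : Site (d + 1)) (v : Idx (d + 1) N → ℂ)
    (A : TorusSite (d + 1) N → Fin (d + 1) → ℂ) (hv : ∀ z : TorusSite (d + 1) N, v (Sum.inl (κ, z)) = ∑ m, A m κ * pw (kFine p m) (repZ z)) :
    ∑ i ∈ legSet d M (Sum.inl κ : Fib d), C * cphase (quo N (legPt M (Sum.inl κ : Fib d) x' i)) p * v (legIdx N (Sum.inl κ : Fib d) (legPt M (Sum.inl κ : Fib d) x' i))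
      = ∑ m, C * readW N M p κ x' m * A m κ := by
  simp only [legIdx, legSet, hv]
  unfold readW
  have step : ∀ i ∈ LegIdx d M, C * cphase (quo N (legPt M (Sum.inl κ : Fib d) x' i)) p
        * ∑ m, A m κ * pw (kFine p m) (repZ (Torus.proj N (legPt M (Sum.inl κ : Fib d) x' i)))
      = ∑ m, C * A m κ * pw (kFine p m) (legPt M (Sum.inl κ : Fib d) x' i) := by
    intro i _
    rw [Finset.mul_sum]
    refine Finset.sum_congr rfl fun m _ => ?_
    rw [← cphase_mul_pw_kFine_repZ p m (legPt M (Sum.inl κ : Fib d) x' i)]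
    ring
  rw [Finset.sum_congr rfl step, Finset.sum_comm]
  refine Finset.sum_congr rfl fun m _ => ?_
  rw [Finset.mul_sum, Finset.sum_mul]
  refine Finset.sum_congr rfl fun i _ => ?_
  ring

/-! ## §4 The closed form of `kFibW` and `kFib` at real quasi-momentum -/

section Real

variable (q : Fin (d + 1) → ℝ) (hL : ∀ m : TorusSite (d + 1) N, lapSym (kFine (ofRealVec q) m) ≠ 0)

/-- [folklore] The capacitance hypothesis for a FIELD source leg, transported to the sources of its leg source vector. -/
theorem capSolves_legSrcVec_inl (M : ℕ) (C : ℂ) (l : Fin (d + 1)) (y' : Site (d + 1)) {φ : Fin (d + 1) → ℂ} {c : ℂ}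
    (hcap : CapSolves (aliasFibre (ofRealVec q) hL) (fieldLegSrc N M (ofRealVec q) C l y') 0 0 0 φ c) :
    CapSolves (aliasFibre (ofRealVec q) hL) (srcEL (ofRealVec q) (legSrcVec N M (ofRealVec q) C (Sum.inl l) y'))
      (srcG (ofRealVec q) (legSrcVec N M (ofRealVec q) C (Sum.inl l) y')) (legSrcVec N M (ofRealVec q) C (Sum.inl l) y' (Sum.inr (Sum.inl 0)))
      (fun κ => legSrcVec N M (ofRealVec q) C (Sum.inl l) y' (Sum.inr (Sum.inr κ))) φ c := by
  rw [srcEL_legSrcVec_inl, srcG_legSrcVec_inl, legSrcVec_inl_M, legSrcVec_inl_Q]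
  exact hcap

/-- [folklore] The capacitance hypothesis for a MULTIPLIER source leg, transported likewise. -/
theorem capSolves_legSrcVec_inr (M : ℕ) (C : ℂ) (l : Fin (d + 1)) (y' : Site (d + 1)) {φ : Fin (d + 1) → ℂ} {c : ℂ}
    (hcap : CapSolves (aliasFibre (ofRealVec q) hL) 0 0 0 (fun κ => if κ = l then C * cphase (-quo N ((M : ℤ) • y')) (ofRealVec q) else 0) φ c) :
    CapSolves (aliasFibre (ofRealVec q) hL) (srcEL (ofRealVec q) (legSrcVec N M (ofRealVec q) C (Sum.inr l) y'))
      (srcG (ofRealVec q) (legSrcVec N M (ofRealVec q) C (Sum.inr l) y')) (legSrcVec N M (ofRealVec q) C (Sum.inr l) y' (Sum.inr (Sum.inl 0)))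
      (fun κ => legSrcVec N M (ofRealVec q) C (Sum.inr l) y' (Sum.inr (Sum.inr κ))) φ c := by
  rw [srcEL_legSrcVec_inr, srcG_legSrcVec_inr, legSrcVec_inr_M, legSrcVec_inr_Q]
  exact hcap

/-- [folklore] **FIELD–FIELD**: `kFibW … (inl κ) x′ (inl l) y′ p = Σ_m C_{f}·readW(κ,x′,m) · Ablk F (fieldLegSrc … C_{f} l y′) 0 φ c m κ` for ANY solution `(φ, c)` of the
capacitance system with the aggregated field source (it exists: `FibInvClosedForm.capSolves_inv`; it is unique: `Capacitance.cap_unique`). -/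
theorem kFibW_inl_inl (M : ℕ) (sf sm : ℝ) (κ : Fin (d + 1)) (x' : Site (d + 1)) (l : Fin (d + 1)) (y' : Site (d + 1))
    {φ : Fin (d + 1) → ℂ} {c : ℂ}
    (hcap : CapSolves (aliasFibre (ofRealVec q) hL) (fieldLegSrc N M (ofRealVec q) (legCoef M sf sm (Sum.inl l : Fib d)) l y') 0 0 0 φ c) :
    kFibW N M sf sm (Sum.inl κ) x' (Sum.inl l) y' (ofRealVec q)
      = ∑ m : TorusSite (d + 1) N, legCoef M sf sm (Sum.inl κ : Fib d) * readW N M (ofRealVec q) κ x' m *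
          Ablk (aliasFibre (ofRealVec q) hL) (fieldLegSrc N M (ofRealVec q) (legCoef M sf sm (Sum.inl l : Fib d)) l y') 0 φ c m κ := by
  rw [kFibW_eq_readout]
  have hcap' := capSolves_legSrcVec_inl q hL M (legCoef M sf sm (Sum.inl l : Fib d)) l y' hcap
  rw [readout_inl M (ofRealVec q) _ κ x' _ _ (fun z => invMulVec_inl q hL _ hcap' κ z)]
  simp only [srcEL_legSrcVec_inl, srcG_legSrcVec_inl]

/-- [folklore] **MULTIPLIER–FIELD**: `kFibW … (inr κ) x′ (inl l) y′ p = C_{m}·cphase(quo N (M•x′)) p · φ κ` with the same `(φ, c)`. -/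
theorem kFibW_inr_inl (M : ℕ) (sf sm : ℝ) (κ : Fin (d + 1)) (x' : Site (d + 1)) (l : Fin (d + 1)) (y' : Site (d + 1))
    {φ : Fin (d + 1) → ℂ} {c : ℂ}
    (hcap : CapSolves (aliasFibre (ofRealVec q) hL) (fieldLegSrc N M (ofRealVec q) (legCoef M sf sm (Sum.inl l : Fib d)) l y') 0 0 0 φ c) :
    kFibW N M sf sm (Sum.inr κ) x' (Sum.inl l) y' (ofRealVec q)
      = legCoef M sf sm (Sum.inr κ : Fib d) * cphase (quo N ((M : ℤ) • x')) (ofRealVec q) * φ κ := by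
  rw [kFibW_eq_readout]
  have hcap' := capSolves_legSrcVec_inl q hL M (legCoef M sf sm (Sum.inl l : Fib d)) l y' hcap
  simp only [legSet, legPt, legIdx, Finset.sum_singleton]
  rw [invMulVec_inr_inr q hL _ hcap' κ]

/-- [folklore] **FIELD–MULTIPLIER**: `kFibW … (inl κ) x′ (inr l) y′ p = Σ_m C_{f}·readW(κ,x′,m) · Ablk F 0 0 φ c m κ` for ANY solution `(φ, c)` of the capacitance
system with the Q-source `C_{m}·cphase(−quo N (M•y′)) p • e_l` (pure border response). -/
theorem kFibW_inl_inr (M : ℕ) (sf sm : ℝ) (κ : Fin (d + 1)) (x' : Site (d + 1)) (l : Fin (d + 1)) (y' : Site (d + 1))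
    {φ : Fin (d + 1) → ℂ} {c : ℂ}
    (hcap : CapSolves (aliasFibre (ofRealVec q) hL) 0 0 0
      (fun κ' => if κ' = l then legCoef M sf sm (Sum.inr l : Fib d) * cphase (-quo N ((M : ℤ) • y')) (ofRealVec q) else 0) φ c) :
    kFibW N M sf sm (Sum.inl κ) x' (Sum.inr l) y' (ofRealVec q)
      = ∑ m : TorusSite (d + 1) N, legCoef M sf sm (Sum.inl κ : Fib d) * readW N M (ofRealVec q) κ x' m *
          Ablk (aliasFibre (ofRealVec q) hL) 0 0 φ c m κ := by
  rw [kFibW_eq_readout]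
  have hcap' := capSolves_legSrcVec_inr q hL M (legCoef M sf sm (Sum.inr l : Fib d)) l y' hcap
  rw [readout_inl M (ofRealVec q) _ κ x' _ _ (fun z => invMulVec_inl q hL _ hcap' κ z)]
  simp only [srcEL_legSrcVec_inr, srcG_legSrcVec_inr]

/-- [folklore] **MULTIPLIER–MULTIPLIER**: `kFibW … (inr κ) x′ (inr l) y′ p = C_{m}·cphase(quo N (M•x′)) p · φ κ` with the `(φ, c)` of `kFibW_inl_inr`
— the `φφ` block of `Cap⁻¹` dressed by the two coarse phases and the units. -/
theorem kFibW_inr_inr (M : ℕ) (sf sm : ℝ) (κ : Fin (d + 1)) (x' : Site (d + 1)) (l : Fin (d + 1)) (y' : Site (d + 1))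
    {φ : Fin (d + 1) → ℂ} {c : ℂ}
    (hcap : CapSolves (aliasFibre (ofRealVec q) hL) 0 0 0
      (fun κ' => if κ' = l then legCoef M sf sm (Sum.inr l : Fib d) * cphase (-quo N ((M : ℤ) • y')) (ofRealVec q) else 0) φ c) :
    kFibW N M sf sm (Sum.inr κ) x' (Sum.inr l) y' (ofRealVec q)
      = legCoef M sf sm (Sum.inr κ : Fib d) * cphase (quo N ((M : ℤ) • x')) (ofRealVec q) * φ κ := by
  rw [kFibW_eq_readout]
  have hcap' := capSolves_legSrcVec_inr q hL M (legCoef M sf sm (Sum.inr l : Fib d)) l y' hcap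
  simp only [legSet, legPt, legIdx, Finset.sum_singleton]
  rw [invMulVec_inr_inr q hL _ hcap' κ]

end Real

/-! ### The step fibre function `kFib Lc s_f s_m j` (`N = Lc^(j+1)`, `M = Lc^j`) -/

section Step

variable {Lc : ℕ} [NeZero Lc] (sf sm : ℕ → ℝ) (j : ℕ) (q : Fin (d + 1) → ℝ)
  (hL : ∀ m : TorusSite (d + 1) (Lc ^ (j + 1)), lapSym (kFine (ofRealVec q) m) ≠ 0)

/-- [folklore] **`kFib`, FIELD–FIELD** (row P1-L05b: `kFib = closed form` on the regular real zone). -/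
theorem kFib_inl_inl (κ : Fin (d + 1)) (x' : Site (d + 1)) (l : Fin (d + 1)) (y' : Site (d + 1)) {φ : Fin (d + 1) → ℂ} {c : ℂ}
    (hcap : CapSolves (aliasFibre (ofRealVec q) hL)
      (fieldLegSrc (Lc ^ (j + 1)) (Lc ^ j) (ofRealVec q) (legCoef (Lc ^ j) (sf j) (sm j) (Sum.inl l : Fib d)) l y') 0 0 0 φ c) :
    kFib Lc sf sm j (Sum.inl κ) x' (Sum.inl l) y' (ofRealVec q)
      = ∑ m : TorusSite (d + 1) (Lc ^ (j + 1)), legCoef (Lc ^ j) (sf j) (sm j) (Sum.inl κ : Fib d) * readW (Lc ^ (j + 1)) (Lc ^ j) (ofRealVec q) κ x' m *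
          Ablk (aliasFibre (ofRealVec q) hL)
            (fieldLegSrc (Lc ^ (j + 1)) (Lc ^ j) (ofRealVec q) (legCoef (Lc ^ j) (sf j) (sm j) (Sum.inl l : Fib d)) l y') 0 φ c m κ :=
  kFibW_inl_inl q hL (Lc ^ j) (sf j) (sm j) κ x' l y' hcap

/-- [folklore] **`kFib`, MULTIPLIER–FIELD.** -/
theorem kFib_inr_inl (κ : Fin (d + 1)) (x' : Site (d + 1)) (l : Fin (d + 1)) (y' : Site (d + 1)) {φ : Fin (d + 1) → ℂ} {c : ℂ}
    (hcap : CapSolves (aliasFibre (ofRealVec q) hL)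
      (fieldLegSrc (Lc ^ (j + 1)) (Lc ^ j) (ofRealVec q) (legCoef (Lc ^ j) (sf j) (sm j) (Sum.inl l : Fib d)) l y') 0 0 0 φ c) :
    kFib Lc sf sm j (Sum.inr κ) x' (Sum.inl l) y' (ofRealVec q)
      = legCoef (Lc ^ j) (sf j) (sm j) (Sum.inr κ : Fib d) * cphase (quo (Lc ^ (j + 1)) (((Lc ^ j : ℕ) : ℤ) • x')) (ofRealVec q) * φ κ :=
  kFibW_inr_inl q hL (Lc ^ j) (sf j) (sm j) κ x' l y' hcap

/-- [folklore] **`kFib`, FIELD–MULTIPLIER.** -/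
theorem kFib_inl_inr (κ : Fin (d + 1)) (x' : Site (d + 1)) (l : Fin (d + 1)) (y' : Site (d + 1)) {φ : Fin (d + 1) → ℂ} {c : ℂ}
    (hcap : CapSolves (aliasFibre (ofRealVec q) hL) 0 0 0
      (fun κ' => if κ' = l then legCoef (Lc ^ j) (sf j) (sm j) (Sum.inr l : Fib d) *
        cphase (-quo (Lc ^ (j + 1)) (((Lc ^ j : ℕ) : ℤ) • y')) (ofRealVec q) else 0) φ c) :
    kFib Lc sf sm j (Sum.inl κ) x' (Sum.inr l) y' (ofRealVec q)
      = ∑ m : TorusSite (d + 1) (Lc ^ (j + 1)), legCoef (Lc ^ j) (sf j) (sm j) (Sum.inl κ : Fib d) * readW (Lc ^ (j + 1)) (Lc ^ j) (ofRealVec q) κ x' m *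
          Ablk (aliasFibre (ofRealVec q) hL) 0 0 φ c m κ :=
  kFibW_inl_inr q hL (Lc ^ j) (sf j) (sm j) κ x' l y' hcap

/-- [folklore] **`kFib`, MULTIPLIER–MULTIPLIER.** -/
theorem kFib_inr_inr (κ : Fin (d + 1)) (x' : Site (d + 1)) (l : Fin (d + 1)) (y' : Site (d + 1)) {φ : Fin (d + 1) → ℂ} {c : ℂ}
    (hcap : CapSolves (aliasFibre (ofRealVec q) hL) 0 0 0
      (fun κ' => if κ' = l then legCoef (Lc ^ j) (sf j) (sm j) (Sum.inr l : Fib d) *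
        cphase (-quo (Lc ^ (j + 1)) (((Lc ^ j : ℕ) : ℤ) • y')) (ofRealVec q) else 0) φ c) :
    kFib Lc sf sm j (Sum.inr κ) x' (Sum.inr l) y' (ofRealVec q)
      = legCoef (Lc ^ j) (sf j) (sm j) (Sum.inr κ : Fib d) * cphase (quo (Lc ^ (j + 1)) (((Lc ^ j : ℕ) : ℤ) • x')) (ofRealVec q) * φ κ :=
  kFibW_inr_inr q hL (Lc ^ j) (sf j) (sm j) κ x' l y' hcap

end Step

end Summit.QuantumFields.BalabanUV.Beta.GAN24.KFibClosedForm

end
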